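import Summits.BirchSwinnertonDyer.Rank1Residual.X12.ClassClosureO10Readings
import HarnessLib

/-!
# Route `InertBadSignedBranches` (rung K8), residual crux `InertBadAtThree` — file 1/4: the SUPPLY of
# the O10-PS pair data at ANY ODD prime (seat bsd-cm-inert g10; helper lemmas, nothing asserted)

The landed O10-PS chain (`X12/ClassClosureO10Readings.lean`, p402929; x1b's
`Additive/QuadraticBranchLowerHalfOfReadings.lean`) carries `hp5 : 5 ≤ p` for exactly three reasons:
(i) `p ≠ 2`; (ii) `ord_p c_p(W) = 0` by Kodaira–Néron (`c_p ≤ 4 < p`); (iii) the typed law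
`Additive.QuadraticBranchMinusLeadingValuationAt W p 0` (C-cc-1) has `5 ≤ p →` inside its body, so it
can only be USED at `p ≥ 5`. At `p = 3` on the inert-bad CM locus (ii) holds for a different reason —
`3 ∤ Tam(W)` for every CM curve with `3` unramified in the CM field
(`X12.not_three_dvd_tamagawaProduct_of_hasCM_of_not_cmRamified_three`) — and (iii) is the planner's
to restate (a guard-free twin of the law; cell bsd-cm ruling D70 after the referee's PASS on memo N21
v1.2, which removed the paper obstruction (GZ_η)@3 at `e = p − 1`).

THIS FILE (1/4): the `p ≥ 5` supply theorems with `5 ≤ p` replaced by `p ≠ 2` (their proofs use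
`5 ≤ p` only through `p ≠ 2`): `exists_goodTwist_pStar_of_hasSignedLocalType_IstarZero_of_ne_two` (a CM
curve of signed local type `(p, I₀*)` is the `p*`-twist of a globally minimal CM curve GOOD at `p` with
`a_p = 0`, `p` inert) and the pair-data eliminator `pairData_elim_of_ne_two` (twin, newform, period
ratio + branch function from the displayed datum `hper`, `W(ℚ_p)[p] = 0`, a generator and its
`p`-divisibility level). Files 2/4, 3/4, 4/4: the law-agnostic pair-level lower half at odd `p` and the
class nodes `LowerHalfOnType p I₀*` (odd `p`) / `LowerHalfOnType 3 I₀*`.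

HONEST STATUS (all four files). Everything is CONDITIONAL on displayed hypotheses: the law (C-cc-1) in
pair form, (C1_η), the reading `h74l` and the period datum `hper` are hypotheses, NOT claimed; the two
residual cruxes of the route stay open; nothing is booked; no label moves. With the three files the
`I₀*`-at-3 half of `InertBadAtThree` reads "kernel modulo C-cc-1@3 ∧ (C1_η)@3 ∧ named facts ∧ one
reading ∧ `hper`", exactly like the `p ≥ 5` node of record (`X12/ClassClosureO10Readings.lean`,
p402929); the `III/III*`-at-3 half is untouched (CONSTRUCTION).
[cite: Kobayashi2003, Thm. 3.2 (p. 7)] [cite: SilvermanATAEC1994, IV.9.4 Step 6 (PDF p. 345)]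
[cite: Lang1987, Ch. 13 §4 Thm. 12 (PDF p. 140)] [cite: SilvermanAEC2009, Prop. VII.6.3 and Thm. VIII.6.7]
-/

set_option autoImplicit false
set_option linter.dupNamespace false

noncomputable section

open scoped Classical MatrixGroups ModularForm NumberField

open CongruenceSubgroup Field Function NumberField IsDedekindDomain IsDedekindDomain.HeightOneSpectrum
  WeierstrassCurve Rat.HeightOneSpectrum
open Literature.NumberTheory.EllipticCurves
open Literature.NumberTheory.EllipticCurves.ModularForms
open Literature.NumberTheory.EllipticCurves.Kobayashi2003
open Literature.NumberTheory.EllipticCurves.Rank1Residual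
open Literature.NumberTheory.EllipticCurves.Rank1Residual.Typed
open Literature.NumberTheory.GaloisRepresentations
open Literature.NumberTheory.GaloisCohomology
open Literature.NumberTheory.EllipticCurves.IwasawaAlgebra
open Summit.BirchSwinnertonDyer.Rank1Residual.Additive
open Summit.BirchSwinnertonDyer.Rank1Residual.Additive.LevelBridge
open Summit.BirchSwinnertonDyer.Rank1Residual
open Summit.BirchSwinnertonDyer.Rank1Residual.X12
open Summit.BirchSwinnertonDyer.Rank1Residual.X12.O10

namespace Summit.BirchSwinnertonDyer.BirchSwinnertonDyer.Theorems.InertBadOdd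

variable (W : WeierstrassCurve ℚ) [W.IsElliptic] (p : ℕ) [hp : Fact p.Prime]

/-! ## §1 Supply at an odd prime: the good `a_p = 0` CM twin and the pair data -/

variable {p}

/-- **SUPPLY at any ODD `p` (any rank): a CM curve of signed local type `(p, I₀*)` is the `p*`-twist of a
globally minimal CM curve `V` GOOD at `p` with `a_p(V) = 0`, `p` inert in the CM field, `j(V) = j(W)`.**
Verbatim the proof of `X12.O10.exists_goodTwist_pStar_of_hasSignedLocalType_IstarZero` (x1b / cc-typer-6),
which uses `5 ≤ p` only through `p ≠ 2`. [cite: SilvermanATAEC1994, IV.9.4 Step 6 (PDF p. 345)]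
[cite: Lang1987, Ch. 13 §4 Thm. 12 (PDF p. 140)] -/
theorem exists_goodTwist_pStar_of_hasSignedLocalType_IstarZero_of_ne_two
    (hT : HasSignedLocalType W p (.Istar 0)) (hp2 : p ≠ 2) :
    ∃ (V : WeierstrassCurve ℚ) (_ : V.IsElliptic) (_ : V.IsGloballyMinimal) (C : VariableChange ℚ),
      C • W.quadraticTwist ((-1) ^ (p / 2) * p) = V ∧ V.HasGoodReductionAtPrime p ∧
        V.frobeniusTrace p = 0 ∧ V.HasCM ∧ CMInert V p ∧ V.j = W.j := by
  -- adapted from X12/ClassClosureO10EtaBranch.lean (`…_IstarZero`), `hp5` replaced by `hp2`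
  have hpP : p.Prime := hp.out
  obtain ⟨hCM, hin, -, hk⟩ := hT
  obtain ⟨v, hv⟩ : ∃ v : HeightOneSpectrum (𝓞 ℚ), (primesEquiv v : ℕ) = p :=
    ⟨primesEquiv.symm ⟨p, hpP⟩, by rw [Equiv.apply_symm_apply]⟩
  have hK : W.kodairaSymbolAt v = .Istar 0 := hk v hv
  have hv2 : (primesEquiv v : ℕ) ≠ 2 := by rw [hv]; exact hp2
  have hu : IsUnit ((-1 : ℤ) ^ (p / 2)) := (isUnit_one.neg).pow _
  have h1 : ((primesEquiv v : ℕ) : ℤ) ∣ (-1) ^ (p / 2) * (p : ℤ) := by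
    rw [hv]; exact Dvd.intro_left _ rfl
  have h2 : ¬ ((primesEquiv v : ℕ) : ℤ) ^ 2 ∣ (-1) ^ (p / 2) * (p : ℤ) := by
    rw [hv, hu.dvd_mul_left]
    intro h2
    have hp0' : (p : ℤ) ≠ 0 := by exact_mod_cast hpP.ne_zero
    have h1 : (p : ℤ) * p ∣ (p : ℤ) * 1 := by simpa [sq] using h2
    have hp1 : (p : ℤ) ∣ 1 := (mul_dvd_mul_iff_left hp0').mp h1
    have := Int.eq_one_of_dvd_one (by positivity) hp1
    have h1' : p = 1 := by exact_mod_cast this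
    exact hpP.one_lt.ne' h1'
  have hgood : (W.quadraticTwist ((((-1) ^ (p / 2) * (p : ℤ) : ℤ)) : ℚ)).HasGoodReductionAt v :=
    hasGoodReductionAt_quadraticTwist_of_kodairaSymbolAt_eq_Istar_zero v W hv2 h1 h2 hK
  have hDq : ((((-1) ^ (p / 2) * (p : ℤ) : ℤ)) : ℚ) = (-1) ^ (p / 2) * p := by push_cast; ring
  rw [hDq] at hgood
  have hD0 : ((-1 : ℚ) ^ (p / 2) * p) ≠ 0 :=
    mul_ne_zero (pow_ne_zero _ (by norm_num)) (by exact_mod_cast hpP.ne_zero)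
  obtain ⟨V, hVe, hVm, C, hC⟩ := exists_isGloballyMinimal_smul_eq_twist W hD0
  have hVgood : V.HasGoodReductionAt v := by
    rw [← hasGoodReductionAt_smul_iff_holds v V C, hC]; exact hgood
  have hVgood' : V.HasGoodReductionAtPrime p := by
    subst hv
    exact (hasGoodReductionAtPrime_iff_hasGoodReductionAt_ringOfIntegers v V).mpr hVgood
  haveI hell : (W.quadraticTwist ((-1 : ℚ) ^ (p / 2) * p)).IsElliptic := W.isElliptic_quadraticTwist hD0
  have hj : V.j = W.j := by
    have h1 : (C • V).j = V.j := variableChange_j V C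
    have h2 : (C • V).j = (W.quadraticTwist ((-1 : ℚ) ^ (p / 2) * p)).j := by
      have key : ∀ (X Y : WeierstrassCurve ℚ) (hX : X.IsElliptic) (hY : Y.IsElliptic),
          X = Y → X.j = Y.j := by
        intro X Y hX hY h; subst h; rfl
      exact key _ _ _ _ hC
    rw [← h1, h2]
    exact W.j_quadraticTwist hD0
  have hCM_V : V.HasCM := (hasCM_iff_j_mem_holds V).mpr (hj ▸ (hasCM_iff_j_mem_holds W).mp hCM)
  have hin_V : CMInert V p := by
    unfold CMInert CMRamified CMSplit at hin ⊢
    rw [hj]; exact hin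
  have hap : V.frobeniusTrace p = 0 := frobeniusTrace_eq_zero_of_hasCM_of_cmInert hCM_V hp2 hVgood' hin_V
  exact ⟨V, hVe, hVm, C⁻¹, by rw [← hC, inv_smul_smul], hVgood', hap, hCM_V, hin_V, hj⟩

/-- **The pair data PRODUCED at any ODD `p`** for a rank-one CM curve of signed local type `(p, I₀*)`
(eliminator form): the twin `V` (§1), its newform (`hnf`), a period ratio and a branch function from the
displayed datum `hper` (`quadraticBranch_hdata_of_periodRatio`, Kobayashi Thm. 3.2), `W(ℚ_p)[p] = 0`,
a generator `P` of `W(ℚ)/tors` (GZK + Mordell–Weil) and its `p`-divisibility level `n`. Verbatim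
`X12.O10.pairData_elim` with `hp5` replaced by `hp2`. [cite: Kobayashi2003, Thm. 3.2 (p. 7)]
[cite: SilvermanAEC2009, Prop. VII.6.3 and Thm. VIII.6.7] -/
theorem pairData_elim_of_ne_two (hGZK : rank_eq_analyticRank_of_analyticRank_le_one)
    (hnf : exists_isNewformOf)
    (hper : ∀ (V : WeierstrassCurve ℚ) [V.IsElliptic] [V.IsGloballyMinimal]
      {N : ℕ} [NeZero N] (f : CuspForm (Gamma0 N) 2), IsNewformOf V f →
      V.HasGoodReductionAtPrime p → V.frobeniusTrace p = 0 →
      ∃ ϖ : ℚ, ‖(ϖ : ℚ_[p])‖ ≤ 1 ∧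
        (if Even (p / 2) then (ϖ : ℝ) * V.realPeriodRat = plusPeriod f
          else (ϖ : ℝ) * V.imaginaryPeriodRat = minusPeriod f))
    (hT : HasSignedLocalType W p (.Istar 0)) (hr : W.analyticRank = 1) (hp2 : p ≠ 2)
    {motive : Prop}
    (k : ∀ (V : WeierstrassCurve ℚ) [V.IsElliptic] [V.IsGloballyMinimal] (C : VariableChange ℚ)
      {N : ℕ} [NeZero N] (f : CuspForm (Gamma0 N) 2) (ϖ : ℚ) (L : IwasawaAlgebra p)
      (P : W.toAffine.Point) (n : ℕ),
      C • W.quadraticTwist ((-1) ^ (p / 2) * p) = V → V.HasGoodReductionAtPrime p →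
      V.frobeniusTrace p = 0 → V.HasCM → CMInert V p → IsNewformOf V f →
      (if Even (p / 2) then (ϖ : ℝ) * V.realPeriodRat = plusPeriod f
        else (ϖ : ℝ) * V.imaginaryPeriodRat = minusPeriod f) →
      IsQuadraticBranchMinusLFunction f p ϖ L →
      (∀ Q : (W.baseChange ℚ_[p]).toAffine.Point, p • Q = 0 → Q = 0) →
      ¬ IsOfFinAddOrder P →
      (∀ R : W.toAffine.Point, ∃ (k : ℤ) (T : W.toAffine.Point),
        IsOfFinAddOrder T ∧ R = k • P + T) →
      (∃ Q : (W.baseChange ℚ_[p]).toAffine.Point, p ^ n • Q = W.toPadicPoint p P) →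
      (∀ Q : (W.baseChange ℚ_[p]).toAffine.Point, p ^ (n + 1) • Q ≠ W.toPadicPoint p P) →
      motive) :
    motive := by
  -- adapted from X12/ClassClosureO10Readings.lean (`pairData_elim`), `hp5` replaced by `hp2`
  obtain ⟨V, hVe, hVm, C, hC, hgood, hap, hCM, hin, -⟩ :=
    exists_goodTwist_pStar_of_hasSignedLocalType_IstarZero_of_ne_two W hT hp2
  haveI : NeZero (V.conductorNorm ℤ) := ⟨(V.conductorNorm_pos_holds).ne'⟩
  obtain ⟨f, hf⟩ := hnf V
  obtain ⟨ϖ, hϖ, L, hL⟩ := quadraticBranch_hdata_of_periodRatio hp2 hper V f hf hgood hap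
  obtain ⟨hrank, -⟩ := hGZK W hr.le
  have hrank1 : W.mordellWeilRank = 1 := by rw [hrank, hr]
  obtain ⟨P, hP, hgen⟩ := exists_generator_of_mordellWeilRank_eq_one W hrank1
  obtain ⟨lam, hlam⟩ := exists_addMonoidHom_padicInt_apply_eq_zero_iff p (W.baseChange ℚ_[p])
  have hinj : Function.Injective (W.toPadicPoint p) :=
    Affine.Point.map_injective (W' := W) (Algebra.ofId ℚ ℚ_[p])
  have hP' : ¬ IsOfFinAddOrder P := by convert hP
  have hPp : ¬ IsOfFinAddOrder (W.toPadicPoint p P) := by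
    intro h
    apply hP'
    obtain ⟨m, hm, hmP⟩ := isOfFinAddOrder_iff_nsmul_eq_zero.mp h
    refine isOfFinAddOrder_iff_nsmul_eq_zero.mpr ⟨m, hm, hinj ?_⟩
    rw [map_nsmul, map_zero]
    exact hmP
  obtain ⟨n, hdiv, hndiv⟩ := StrictSha.exists_level_of_not_isOfFinAddOrder p lam hlam hPp
  have hgen' : ∀ R : W.toAffine.Point, ∃ (k : ℤ) (T : W.toAffine.Point),
      IsOfFinAddOrder T ∧ R = k • P + T := fun R ↦ by
    obtain ⟨a, t, ht, hR⟩ := hgen R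
    exact ⟨a, t, by convert ht, by convert hR⟩
  exact k V C f ϖ L P n hC hgood hap hCM hin hf hϖ hL
    (eq_zero_of_prime_smul_eq_zero_padic_of_quadraticTwist_goodSupersingular hp2 W C V hC hgood hap)
    hP' hgen' hdiv hndiv


end Summit.BirchSwinnertonDyer.BirchSwinnertonDyer.Theorems.InertBadOdd

end
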